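import Literature.MathematicalPhysics.QuantumFieldTheory.Balaban1983to89.BlockAveragingEMLHaarAC
import Literature.MathematicalPhysics.QuantumFieldTheory.Balaban1983to89.T4TriangularPushforward
import Literature.MathematicalPhysics.QuantumFieldTheory.Balaban1983to89.PlaquetteVariableHaarLaw
import Literature.MathematicalPhysics.QuantumFieldTheory.Balaban1983to89.HaarDist1LevelHypersurface
import Literature.MathematicalPhysics.QuantumFieldTheory.Balaban1983to89.B14Eq12InteriorLocality
import Literature.MathematicalPhysics.QuantumFieldTheory.Balaban1983to89.B12RTGaugeInvariance254
import Literature.MathematicalPhysics.QuantumFieldTheory.Balaban1983to89.T3UnitLawGaugeInvariance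
import Literature.MathematicalPhysics.QuantumFieldTheory.Balaban1983to89.T3UnitLawDensityEML
import Literature.MathematicalPhysics.QuantumFieldTheory.Balaban1983to89.T4AveragingDisintegration
import Summits.QuantumFields.YangMills.Theorems.BalabanUVNodesN09CentralWindowAtRecord
import HarnessLib

/-!
# LEVEL-NEAR for the WREG fibred-chart table — LETTERS (displayed pivot families, gauge transport, the Fubini ∕ Lusin–Souslin core)

Cell `ym3-torus` (rung R3: continuum `SU(2)` Yang–Mills on `T³` — NOT `d = 4`, NOT infinite volume, NOT a mass gap, NOT Clay), width seat
`ym-ust-20520-w4` g14; helper for the crux `stmt-QuantumFields-20520` through the organ WREG of LINE g18-2 `Cruxes/…/Lines/wreg_chart.lean`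
(ideator ym-r3-idea-1), stub **LEVEL-NEAR** `stub_levelFlatNear : LevelFlatNear`; the theorem `levelFlatNear_of_chain` is the sibling module
`…WregChartLevelNear`.  Everything is stated for a DISPLAYED pivot ∕ chain ∕ window system `β ∕ cm ∕ cw` of the iterated (0.4) averaging (the
line's `iterCentralBond ∕ chainMap ∕ chainWindow` satisfy the displayed recursions by `rfl` ∕ `chainWindow_succ`).  §1 pivot families
(`beta_injective`, `exists_beta_eq(_centralBond)`, triangularity `isLocal_iter`, far agreement `iter_apply_eq_of_agree_off`); §2 gauge transport for
ANY fine `u` (`gaugeAct_update`, `window_gaugeAct_iff`, `cm_gaugeAct`, `cw_gaugeAct`, `dist1_plaqHol_iter_update_gaugeAct`, `transfUp_lift_single`);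
§3 the soft half (`ae_ae_forall_not_of_prod_null`, `forall_of_ae_of_mul_right`, `map_iter_absolutelyContinuous`, `fieldMeasure_setOf_dist1_plaqHol_iter_eq_zero`,
`measurableSet_dist1_plaqHol_iter_update`, `measurePreserving_update_pi` ∕ `_fieldMeasure`, `prod_setOf_dist1_plaqHol_iter_update_eq_zero`).
v2 (this file): the resampling lemma is re-sourced in-file and the `…N08HaarCompatibilityGuardReparamFibre` import dropped — its closure carries
global `GaugeField` topology instances (`SubstrateBackground`) that break four proofs of the consumer line file (px13 g8's bisection); every v1
(p728800) declaration is byte-identical.  HONEST SCOPE: measure theory and lattice bookkeeping about the published formula (0.4); no estimate of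
Bałaban's is asserted; the crux, WREG, S2β, every rung statement, `YM3TorusSU2` and the Yang–Mills mass gap (Clay) are NOT proved here.
References: [Balaban1987RG1] CMP 109 (1987) (0.4) p. 253; [Balaban1985Averaging] CMP 98 (1985) (8)–(12) p. 19; [BrockerTomDieck1985] IV (2.11).
-/
noncomputable section

open MeasureTheory Filter Topology Set Function
open scoped ENNReal NNReal
open Literature.MathematicalPhysics.QuantumFieldTheory.Balaban1983to89
open Literature.MathematicalPhysics.QuantumFieldTheory.Balaban1983to89.T3UnitLawDensityEML (ℰp)
open Literature.MathematicalPhysics.QuantumFieldTheory.Balaban1983to89.BlockAveraging (Idx avgFun loopHol loopHol_gaugeAct measurable_avgFun)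
open Literature.MathematicalPhysics.QuantumFieldTheory.Balaban1983to89.BlockAveragingHaarAC (centralBond centralBond_injective isLocal_avgFun pre post)
open Literature.MathematicalPhysics.QuantumFieldTheory.Balaban1983to89.BlockAveragingEMLHaarAC (fibreFamily loopHol_update_centralBond_self)
open Literature.MathematicalPhysics.QuantumFieldTheory.Balaban1983to89.T4Continuum (transfUp iter_gaugeAct)
open Literature.MathematicalPhysics.QuantumFieldTheory.Balaban1983to89.T4TriangularPushforward (IsLocal apply_eq_of_agree)
open Literature.MathematicalPhysics.QuantumFieldTheory.Balaban1983to89.T4WilsonGaugeFlatDirection (plaqHol_gaugeAct)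

namespace Summit.QuantumFields.YangMills.Theorems.FluctuationComparisonRegPrIntLWregChartLevelNear
variable {P : Params}

/-! ## §1 Displayed pivot families: injectivity, ancestors, triangularity, far agreement off one chain -/

section Beta
variable (β : (k : ℕ) → PBond P k → PBond P 0) (hβ0 : ∀ b, β 0 b = b)
  (hβs : ∀ k (c : PBond P (k + 1)), β (k + 1) c = β k (centralBond c))

include hβ0 hβs in
/-- A displayed pivot family is injective at every level of the standing range. [folklore] -/
theorem beta_injective : ∀ {k : ℕ}, k ≤ P.m + P.K → Injective (β k)
  | 0, _ => fun a b h => by rwa [hβ0, hβ0] at h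
  | k + 1, hk => fun a b h => by
      rw [hβs, hβs] at h
      exact centralBond_injective (by omega) (beta_injective (k := k) (by omega) h)

include hβs in
/-- Every level-`n` pivot is a level-`j` pivot of its level-`j` ancestor, `j ≤ n`. [folklore] -/
-- adapted from Cruxes/FluctuationComparisonRegPrIntL/Lines/wreg_chart.lean v15 §4g (`exists_iterCentralBond_eq`), β-abstracted
theorem exists_beta_eq (j : ℕ) : ∀ n, j ≤ n → ∀ c : PBond P n, ∃ b : PBond P j, β n c = β j b := by
  intro n hn
  induction n, hn using Nat.le_induction with
  | base => intro c; exact ⟨c, rfl⟩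
  | succ n hn ih =>
      intro c
      obtain ⟨b, hb⟩ := ih (centralBond c)
      exact ⟨b, by rw [hβs, hb]⟩

include hβs in
/-- For `j < n` the level-`j` ancestor is a CENTRAL bond: `β n c = β j (centralBond d)` for some level-`(j+1)` bond `d`. [folklore] -/
theorem exists_beta_eq_centralBond (j : ℕ) {n : ℕ} (hjn : j < n) (c : PBond P n) :
    ∃ d : PBond P (j + 1), β n c = β j (centralBond d) := by
  obtain ⟨d, hd⟩ := exists_beta_eq β hβs (j + 1) n hjn c
  exact ⟨d, by rw [hd, hβs]⟩

variable {G : Type*} [GaugeGroup G]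

include hβ0 hβs in
/-- ★ The `k`-fold block averaging is TRIANGULAR in a displayed pivot family (`IsLocal (β k) Ū⁽ᵏ⁾`): by induction from the
one-step locality `isLocal_avgFun`. [cite: Balaban1987RG1, (0.4) p.253] -/
-- adapted from Cruxes/FluctuationComparisonRegPrIntL/Lines/wreg_chart.lean v15 §0 (`isLocal_iter_blockAvg`), β-abstracted
theorem isLocal_iter (ℰ : LoopAverage G) :
    ∀ {k : ℕ}, k ≤ P.m + P.K → IsLocal (β k) (Averaging.iter (fun i => BlockAveraging.blockAvg (P := P) (j := i) ℰ) k)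
  | 0, _ => by
      intro U c g c' hc
      show update U (β 0 c) g c' = U c'
      rw [hβ0, update_of_ne hc]
  | k + 1, hk => by
      intro U c g c' hc
      have IH := isLocal_iter ℰ (k := k) (by omega)
      set V := Averaging.iter (fun i => BlockAveraging.blockAvg (P := P) (j := i) ℰ) k (update U (β (k + 1) c) g) with hV
      set V₀ := Averaging.iter (fun i => BlockAveraging.blockAvg (P := P) (j := i) ℰ) k U with hV₀
      have hVeq : V = update V₀ (centralBond c) (V (centralBond c)) := by
        funext b
        by_cases hb : b = centralBond c
        · subst hb; simp
        · rw [update_of_ne hb, hV, hβs]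
          exact IH U (centralBond c) g b hb
      show BlockAveraging.avgFun ℰ V c' = BlockAveraging.avgFun ℰ V₀ c'
      rw [hVeq]
      exact isLocal_avgFun (by omega) ℰ V₀ c (V (centralBond c)) c' hc

include hβ0 hβs in
/-- ★ **FAR AGREEMENT OFF A SINGLE CHAIN**: if `U`, `U′` differ only at pivots `β n c′` of bonds `c′ ≠ c`, then at every level
`j ≤ n` their averages agree at every bond `b′` off the traces of those chains. [cite: Balaban1987RG1, (0.4) p.253] -/
theorem iter_apply_eq_of_agree_off (ℰ : LoopAverage G) {n : ℕ} (hn : n ≤ P.m + P.K) (c : PBond P n) (U U' : GaugeField P 0 G)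
    (hUU' : ∀ b, U b ≠ U' b → ∃ c', c' ≠ c ∧ β n c' = b) {j : ℕ} (hj : j ≤ n) (b' : PBond P j)
    (hb' : ∀ c', c' ≠ c → β j b' ≠ β n c') :
    Averaging.iter (fun i => BlockAveraging.blockAvg (P := P) (j := i) ℰ) j U b' =
      Averaging.iter (fun i => BlockAveraging.blockAvg (P := P) (j := i) ℰ) j U' b' := by
  classical
  refine apply_eq_of_agree (isLocal_iter β hβ0 hβs ℰ (by omega)) b' (Finset.univ.filter fun b => U b ≠ U' b) U U'
    (fun b hb => by simpa using hb) ?_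
  intro b hb
  have hne : U b ≠ U' b := (Finset.mem_filter.mp hb).2
  obtain ⟨c', hc', hc'b⟩ := hUU' b hne
  obtain ⟨b'', hb''⟩ := exists_beta_eq β hβs j n hj c'
  refine ⟨b'', ?_, by rw [← hb'', hc'b]⟩
  rintro rfl
  exact hb' c' hc' hb''.symm

end Beta
/-! ## §2 Gauge transport of pivots, windows, chain values and plaquette variables -/

section GaugeSec

variable {G : Type*} [GaugeGroup G]

/-- `(U[b ↦ g])^u = U^u[b ↦ u(b₋) g u(b₊)⁻¹]`: updating after a gauge transformation is updating before it with the pivot value conjugated at the endpoints. [cite: Balaban1985Averaging, (8) p.19] -/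
theorem gaugeAct_update {j : ℕ} (u : GaugeTransf P j G) (U : GaugeField P j G) (b : PBond P j) (g : G) :
    GaugeField.gaugeAct u (update U b g) = update (GaugeField.gaugeAct u U) b (u b.src * g * (u b.tgt)⁻¹) := by
  funext b'
  by_cases h : b' = b
  · subst h; simp [GaugeField.gaugeAct]
  · simp [GaugeField.gaugeAct, update_of_ne h]

/-- ★ **THE CENTRAL WINDOW IS GAUGE COVARIANT**: the window condition «all loop variables of `V[centralBond c ↦ ·]` at `c` are
`≤ α`» at the conjugated pivot value in the environment `V^τ` is the window condition in the environment `V`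
(`loopHol_update_centralBond_self` + `loopHol_gaugeAct` + `dist1_conj`). [cite: Balaban1985Averaging, (8)-(11) p.19] -/
theorem window_gaugeAct_iff {k : ℕ} (hk : k + 1 ≤ P.m + P.K) (τ : GaugeTransf P k G) (V : GaugeField P k G)
    (c : PBond P (k + 1)) (α : ℝ) (w : G) :
    (∀ i : Idx P, dist1 (fibreFamily (GaugeField.gaugeAct τ V) c
        (pre (GaugeField.gaugeAct τ V) c * (τ (centralBond c).src * w * (τ (centralBond c).tgt)⁻¹) *
          post (GaugeField.gaugeAct τ V) c) i) ≤ α) ↔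
      (∀ i : Idx P, dist1 (fibreFamily V c (pre V c * w * post V c) i) ≤ α) := by
  rw [← loopHol_update_centralBond_self hk, ← loopHol_update_centralBond_self hk, ← gaugeAct_update]
  refine forall_congr' fun i => ?_
  rw [loopHol_gaugeAct, GaugeGroup.dist1_conj]

section Chain

variable (ℰ : LoopAverage G) (α : ℝ)
  (β : (k : ℕ) → PBond P k → PBond P 0) (hβs : ∀ k (c : PBond P (k + 1)), β (k + 1) c = β k (centralBond c))
  (cm : (k : ℕ) → GaugeField P 0 G → PBond P k → G → G)
  (hcm : ∀ k U (c : PBond P k) g, cm k U c g =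
    Averaging.iter (fun i => BlockAveraging.blockAvg (P := P) (j := i) ℰ) k (update U (β k c) g) c)
  (cw : (k : ℕ) → GaugeField P 0 G → PBond P k → Set G)
  (hcw0 : ∀ U (c : PBond P 0), cw 0 U c = univ)
  (hcws : ∀ k U (c : PBond P (k + 1)), cw (k + 1) U c = cw k U (centralBond c) ∩
    cm k U (centralBond c) ⁻¹'
      {h | ∀ i : Idx P, dist1 (fibreFamily (Averaging.iter (fun i => BlockAveraging.blockAvg (P := P) (j := i) ℰ) k U) c
        (pre (Averaging.iter (fun i => BlockAveraging.blockAvg (P := P) (j := i) ℰ) k U) c * h *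
          post (Averaging.iter (fun i => BlockAveraging.blockAvg (P := P) (j := i) ℰ) k U) c) i) ≤ α})

include hcm in
/-- ★ **THE CHAIN MAP IS GAUGE COVARIANT**: in the environment `z^u`, at the conjugated pivot value, the chain value is the
old one conjugated by the level-`k` image `u⁽ᵏ⁾` at the endpoints of the coarse bond (`iter_gaugeAct`). [cite: Balaban1985Averaging, (11) p.19] -/
theorem cm_gaugeAct (u : GaugeTransf P 0 G) {k : ℕ} (hk : k ≤ P.m + P.K) (z : GaugeField P 0 G) (c : PBond P k) (g : G) :
    cm k (GaugeField.gaugeAct u z) c (u (β k c).src * g * (u (β k c).tgt)⁻¹) =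
      transfUp u k c.src * cm k z c g * (transfUp u k c.tgt)⁻¹ := by
  rw [hcm, hcm, ← gaugeAct_update, iter_gaugeAct _ u k hk]
  rfl

include hβs hcm hcw0 hcws in
/-- ★★ **THE ITERATED CENTRAL WINDOW IS GAUGE COVARIANT**: `cw k (z^u) c` is the image of `cw k z c` under the pivot
reparametrisation `g ↦ u(b₋) g u(b₊)⁻¹`, `b = β k c` (induction on `k`: `cm_gaugeAct` + `window_gaugeAct_iff`). [cite: Balaban1985Averaging, (11) p.19] -/
theorem cw_gaugeAct (u : GaugeTransf P 0 G) :
    ∀ {k : ℕ}, k ≤ P.m + P.K → ∀ (z : GaugeField P 0 G) (c : PBond P k),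
      cw k (GaugeField.gaugeAct u z) c = (fun g => u (β k c).src * g * (u (β k c).tgt)⁻¹) '' cw k z c
  | 0, _ => fun z c => by
      rw [hcw0, hcw0, image_univ_of_surjective]
      intro g'
      exact ⟨(u (β 0 c).src)⁻¹ * g' * u (β 0 c).tgt, by group⟩
  | k + 1, hk => fun z c => by
      have IH := cw_gaugeAct u (k := k) (by omega) z (centralBond c)
      rw [hcws, hcws, IH, ← hβs, iter_gaugeAct _ u k (by omega)]
      ext g'
      simp only [mem_inter_iff, mem_image, mem_preimage, mem_setOf_eq]
      constructor
      · rintro ⟨⟨g, hg, rfl⟩, hw⟩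
        refine ⟨g, ⟨hg, ?_⟩, rfl⟩
        rw [hβs, cm_gaugeAct ℰ β cm hcm u (by omega)] at hw
        exact (window_gaugeAct_iff hk _ _ c α _).1 hw
      · rintro ⟨g, ⟨hg, hw⟩, rfl⟩
        refine ⟨⟨g, hg, rfl⟩, ?_⟩
        rw [hβs, cm_gaugeAct ℰ β cm hcm u (by omega)]
        exact (window_gaugeAct_iff hk _ _ c α _).2 hw

end Chain

/-- ★ **PLAQUETTE VARIABLES OF THE PIVOT-UPDATED AVERAGED FIELD ARE GAUGE INVARIANT** (with the conjugated pivot value):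
`|Ū⁽ʲ⁾(z^u[b ↦ u(b₋)gu(b₊)⁻¹])(∂p) − 1| = |Ū⁽ʲ⁾(z[b ↦ g])(∂p) − 1|`. [cite: Balaban1985Averaging, (9)-(11) p.19] -/
theorem dist1_plaqHol_iter_update_gaugeAct (ℰ : LoopAverage G) (u : GaugeTransf P 0 G) {j : ℕ} (hj : j ≤ P.m + P.K)
    (z : GaugeField P 0 G) (b : PBond P 0) (g : G) (p : Plaq P j) :
    dist1 (GaugeField.plaqHol (Averaging.iter (fun i => BlockAveraging.blockAvg (P := P) (j := i) ℰ) j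
        (update (GaugeField.gaugeAct u z) b (u b.src * g * (u b.tgt)⁻¹))) p) =
      dist1 (GaugeField.plaqHol (Averaging.iter (fun i => BlockAveraging.blockAvg (P := P) (j := i) ℰ) j (update z b g)) p) := by
  rw [← gaugeAct_update, iter_gaugeAct _ u j hj, plaqHol_gaugeAct, GaugeGroup.dist1_conj]

/-- The block-constant lift of the one-site level-`n` transformation `w = [y = c₊ ↦ h]` restricts to `w` (`transfUp_blockUp`),
so it is `1` at `c₋` and `h` at `c₊`. [cite: Balaban1985Averaging, (12) p.19] -/
theorem transfUp_lift_single {n : ℕ} (hn : n ≤ P.m + P.K) (c : PBond P n) (h : G) :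
    transfUp (fun z : Site P 0 => (if T3UnitLawGaugeInvariance.blockUp n z = c.tgt then h else 1 : G)) n c.tgt = h ∧
    transfUp (fun z : Site P 0 => (if T3UnitLawGaugeInvariance.blockUp n z = c.tgt then h else 1 : G)) n c.src = 1 := by
  have key := T3UnitLawGaugeInvariance.transfUp_blockUp (G := G) n hn (fun y => if y = c.tgt then h else 1)
  have hne : c.src ≠ c.tgt := fun e => T4WilsonLinkAffine.shift_ne_self c.src c.dir (e.symm)
  refine ⟨?_, ?_⟩
  · have := congrFun key c.tgt
    simpa using this
  · have := congrFun key c.src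
    simpa [hne] using this

end GaugeSec
/-! ## §3 The soft half: the abstract Fubini ∕ Lusin–Souslin core and its `SU(2)` inputs -/

section Core

variable {Z G : Type*} [MeasurableSpace Z] [MeasurableSpace G]

/-- ★★ **A.E. VALUES FROM A NULL FIBRED EVENT** (abstract core of the soft half).  `μ` on environments `Z`, `ν` on pivot values
`G`; a jointly measurable window `cw z ⊆ G` and chain map `cm z : G → G`, injective and null-preserving (Lusin (N)) on the window;
a jointly measurable «bad» event `D` which is `(μ ⊗ ν)`-null.  Then for `ν`-a.e. VALUE `v`, for `μ`-a.e. `z`, no window point `g`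
with `cm z g = v` is bad.  (Lusin–Souslin measurability of the injective image, `Measure.prod_apply`, sections of a null set
are a.e. null, `Measure.prod_swap`.) [folklore] -/
theorem ae_ae_forall_not_of_prod_null [StandardBorelSpace Z] [StandardBorelSpace G]
    [MeasurableSpace.CountablySeparated (Z × G)]
    (μ : Measure Z) [SFinite μ] (ν : Measure G) [SFinite ν]
    (cm : Z → G → G) (cw : Z → Set G) (D : Z → G → Prop)
    (hcw : MeasurableSet {q : Z × G | q.2 ∈ cw q.1}) (hcm : Measurable fun q : Z × G => cm q.1 q.2)
    (hinj : ∀ z, InjOn (cm z) (cw z))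
    (hN : ∀ z (A : Set G), A ⊆ cw z → ν A = 0 → ν (cm z '' A) = 0)
    (hD : MeasurableSet {q : Z × G | D q.1 q.2}) (hD0 : (μ.prod ν) {q : Z × G | D q.1 q.2} = 0) :
    ∀ᵐ v ∂ν, ∀ᵐ z ∂μ, ∀ g ∈ cw z, cm z g = v → ¬ D z g := by
  classical
  set S : Set (Z × G) := {q | q.2 ∈ cw q.1} with hS
  set B : Set (Z × G) := S ∩ {q | D q.1 q.2} with hB
  set Θ : Z × G → Z × G := fun q => (q.1, cm q.1 q.2) with hΘ
  have hΘm : Measurable Θ := measurable_fst.prodMk hcm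
  have hΘinj : InjOn Θ S := by
    rintro ⟨z, g⟩ hg ⟨z', g'⟩ hg' h
    simp only [hΘ, Prod.mk.injEq] at h
    obtain ⟨rfl, h2⟩ := h
    exact Prod.ext rfl (hinj z hg hg' h2)
  have hBm : MeasurableSet B := hcw.inter hD
  have hEm : MeasurableSet (Θ '' B) := hBm.image_of_measurable_injOn hΘm (hΘinj.mono inter_subset_left)
  -- sections of `B` are `ν`-null for a.e. `z`
  have hB0 : (μ.prod ν) B = 0 := measure_mono_null inter_subset_right hD0
  have hsec : ∀ᵐ z ∂μ, ν (Prod.mk z ⁻¹' B) = 0 := Measure.measure_ae_null_of_prod_null hB0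
  -- the image event is null
  have hE0 : (μ.prod ν) (Θ '' B) = 0 := by
    rw [Measure.prod_apply hEm]
    refine (lintegral_congr_ae (hsec.mono fun z hz => ?_)).trans lintegral_zero
    have hsub : Prod.mk z ⁻¹' (Θ '' B) = cm z '' (Prod.mk z ⁻¹' B) := by
      ext v
      simp only [mem_preimage, mem_image, hΘ, Prod.mk.injEq, Prod.exists]
      constructor
      · rintro ⟨z', g, hq, rfl, rfl⟩; exact ⟨g, hq, rfl⟩
      · rintro ⟨g, hq, rfl⟩; exact ⟨z, g, hq, rfl, rfl⟩
    rw [hsub]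
    exact hN z _ (fun g hg => hg.1) hz
  -- swap the factors: for a.e. value `v`, the `z`-section of the image event is `μ`-null
  have hE0' : (ν.prod μ) (Prod.swap ⁻¹' (Θ '' B)) = 0 := by
    rw [← Measure.prod_swap, Measure.map_apply measurable_swap (measurable_swap hEm)]
    have hss : Prod.swap ⁻¹' (Prod.swap ⁻¹' (Θ '' B)) = Θ '' B := by
      ext q; simp
    rw [hss]
    exact hE0
  have hsec' : ∀ᵐ v ∂ν, μ (Prod.mk v ⁻¹' (Prod.swap ⁻¹' (Θ '' B))) = 0 := Measure.measure_ae_null_of_prod_null hE0'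
  filter_upwards [hsec'] with v hv
  rw [measure_eq_zero_iff_ae_notMem] at hv
  filter_upwards [hv] with z hz g hg hgv hDzg
  exact hz ⟨(z, g), ⟨hg, hDzg⟩, by simp [hΘ, hgv]⟩

/-- **A.E. + INVARIANCE UNDER A TRANSITIVE FAMILY ⇒ EVERYWHERE**: a property of `ν`-almost every point of a group that is
transported by every right translation holds at every point (`ν ≠ 0`). [folklore] -/
theorem forall_of_ae_of_mul_right {G : Type*} [Group G] [MeasurableSpace G] (ν : Measure G) [NeZero ν] {Q : G → Prop}
    (hae : ∀ᵐ v ∂ν, Q v) (hinv : ∀ v h, Q v → Q (v * h)) : ∀ v, Q v := by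
  obtain ⟨v₀, hv₀⟩ := hae.exists
  intro v
  have := hinv v₀ (v₀⁻¹ * v) hv₀
  rwa [mul_inv_cancel_left] at this

end Core
/-! ### `SU(2)` inputs -/

section SU2

/-- The law of `Ū⁽ʲ⁾` under product Haar on `SU(2)` is absolutely continuous, `j ≤ m + K` (`HaarAC` of (0.4) iterated). [cite: Balaban1987RG1, (0.4) p.253] -/
-- adapted from Cruxes/FluctuationComparisonRegPrIntL/Lines/wreg_chart.lean v15 §4g (same name), generic `P`
theorem map_iter_absolutelyContinuous :
    ∀ j, j ≤ P.m + P.K →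
      (fieldMeasure P 0 (Matrix.specialUnitaryGroup (Fin 2) ℂ)).map
          (Averaging.iter (fun i => BlockAveraging.blockAvg (P := P) (j := i) ℰp) j) ≪
        fieldMeasure P j (Matrix.specialUnitaryGroup (Fin 2) ℂ)
  | 0, _ => by
      rw [show Averaging.iter (fun i => BlockAveraging.blockAvg (P := P) (j := i) ℰp) 0 = id from rfl, Measure.map_id]
  | j + 1, hj => by
      have ih := map_iter_absolutelyContinuous j (by omega)
      have hmi : Measurable (Averaging.iter (fun i => BlockAveraging.blockAvg (P := P) (j := i) ℰp) j) :=
        T4Continuum.measurable_iter _ (fun j => by rw [BlockAveraging.blockAvg_avg]; exact measurable_avgFun _ ExpMeanLog.measurable_expMeanLogSU_E) j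
      have hma : Measurable (avgFun ℰp : GaugeField P j (Matrix.specialUnitaryGroup (Fin 2) ℂ) → _) :=
        measurable_avgFun _ ExpMeanLog.measurable_expMeanLogSU_E
      rw [show Averaging.iter (fun i => BlockAveraging.blockAvg (P := P) (j := i) ℰp) (j + 1) =
          avgFun ℰp ∘ Averaging.iter (fun i => BlockAveraging.blockAvg (P := P) (j := i) ℰp) j from rfl,
        ← Measure.map_map hma hmi]
      exact (ih.map hma).trans (BlockAveragingEMLHaarAC.haarAC_avgFun_expMeanLogSU_of_le (P := P) (j := j) hj)

/-- **Threshold level sets of an averaged plaquette variable are `fieldMeasure`-null**: `dU{U : |Ū⁽ʲ⁾U(∂p) − 1| = t} = 0`, `t ≠ 0`. [cite: Balaban1987RG1, (0.4) p.253] -/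
-- adapted from the `hnull` step of `levelFlat_far`, Cruxes/FluctuationComparisonRegPrIntL/Lines/wreg_chart.lean v15 §4g
theorem fieldMeasure_setOf_dist1_plaqHol_iter_eq_zero {j : ℕ} (hj : j ≤ P.m + P.K) (p : Plaq P j) {t : ℝ} (ht : t ≠ 0) :
    fieldMeasure P 0 (Matrix.specialUnitaryGroup (Fin 2) ℂ)
      {U | dist1 (GaugeField.plaqHol (Averaging.iter (fun i => BlockAveraging.blockAvg (P := P) (j := i) ℰp) j U) p) = t} = 0 := by
  set A := Averaging.iter (fun i => BlockAveraging.blockAvg (P := P) (j := i) ℰp) j with hA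
  have hmi : Measurable A :=
    T4Continuum.measurable_iter _ (fun j => by rw [BlockAveraging.blockAvg_avg]; exact measurable_avgFun _ ExpMeanLog.measurable_expMeanLogSU_E) j
  have h1 : fieldMeasure P j (Matrix.specialUnitaryGroup (Fin 2) ℂ) {V | dist1 (GaugeField.plaqHol V p) = t} = 0 :=
    PlaquetteVariableHaarLaw.fieldMeasure_setOf_dist1_plaqHol_eq_eq_zero p
      (HaarEigenvalueSphereNull.haar_setOf_dist1_eq_eq_zero_specialUnitaryGroup (n := Fin 2) ht)
  have h2 := map_iter_absolutelyContinuous (P := P) j hj h1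
  exact le_antisymm ((Measure.le_map_apply hmi.aemeasurable _).trans h2.le) bot_le

/-- The bad event «the pivot-updated averaged field has `|Ū⁽ʲ⁾(∂p) − 1| = t`» is jointly measurable in (environment, pivot). [cite: Balaban1987RG1, (0.4) p.253] -/
theorem measurableSet_dist1_plaqHol_iter_update {j : ℕ} (p : Plaq P j) (b : PBond P 0) (t : ℝ) :
    MeasurableSet {q : GaugeField P 0 (Matrix.specialUnitaryGroup (Fin 2) ℂ) × Matrix.specialUnitaryGroup (Fin 2) ℂ |
      dist1 (GaugeField.plaqHol (Averaging.iter (fun i => BlockAveraging.blockAvg (P := P) (j := i) ℰp) j (update q.1 b q.2)) p) = t} := by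
  have hmi : Measurable (Averaging.iter (fun i => BlockAveraging.blockAvg (P := P) (j := i) ℰp) j) :=
    T4Continuum.measurable_iter _ (fun j => by rw [BlockAveraging.blockAvg_avg]; exact measurable_avgFun _ ExpMeanLog.measurable_expMeanLogSU_E) j
  have hf : Measurable fun q : GaugeField P 0 (Matrix.specialUnitaryGroup (Fin 2) ℂ) × Matrix.specialUnitaryGroup (Fin 2) ℂ =>
      dist1 (GaugeField.plaqHol (Averaging.iter (fun i => BlockAveraging.blockAvg (P := P) (j := i) ℰp) j (update q.1 b q.2)) p) :=
    RegularGaugeGroup.measurable_dist1.comp ((Missing.measurable_plaqHol p).comp (hmi.comp measurable_update'))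
  exact hf (measurableSet_singleton t)

/-- Resampling one coordinate of a product probability law by a fresh sample preserves it: `(U, g) ↦ U[b ↦ g]` is measure preserving
`μ^ι ⊗ μ → μ^ι` (box computation, `Measure.pi_eq`; v2: re-sourced in-file from N08's `measurePreserving_update`, same proof). [folklore] -/
theorem measurePreserving_update_pi {ι X : Type*} [Fintype ι] [DecidableEq ι] [MeasurableSpace X] (μ : Measure X) [IsProbabilityMeasure μ]
    (b : ι) : MeasurePreserving (fun q : (ι → X) × X => update q.1 b q.2) ((Measure.pi fun _ : ι => μ).prod μ) (Measure.pi fun _ : ι => μ) := by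
  have hm : Measurable (fun q : (ι → X) × X => update q.1 b q.2) := measurable_update'
  refine ⟨hm, (Measure.pi_eq fun s hs => ?_).symm⟩
  have hpre : (fun q : (ι → X) × X => update q.1 b q.2) ⁻¹' Set.univ.pi s = (Set.univ.pi (update s b Set.univ)) ×ˢ s b := by
    ext ⟨U, g⟩
    simp only [Set.mem_preimage, Set.mem_univ_pi, Set.mem_prod]
    refine ⟨fun h => ⟨fun i => ?_, by simpa using h b⟩, fun h i => ?_⟩ <;> by_cases hi : i = b
    · subst hi; simp
    · simpa [update_of_ne hi] using h i
    · subst hi; simpa using h.2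
    · simpa [update_of_ne hi] using h.1 i
  rw [Measure.map_apply hm (MeasurableSet.univ_pi hs), hpre, Measure.prod_prod, Measure.pi_pi,
    Finset.prod_eq_mul_prod_sdiff_singleton_of_mem (Finset.mem_univ b) (fun i => μ (update s b Set.univ i)), update_self, measure_univ,
    one_mul, Finset.prod_eq_mul_prod_sdiff_singleton_of_mem (Finset.mem_univ b) (fun i => μ (s i)), mul_comm]
  exact congrArg (μ (s b) * ·) (Finset.prod_congr rfl fun i hi => by rw [update_of_ne (by simpa using hi)])

/-- **A bond update resampled from Haar preserves `dU`**: `(U, g) ↦ U[b ↦ g]` pushes `dU ⊗ Haar` to `dU` (N08's box computation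
`measurePreserving_update`, read on `GaugeField`). [cite: Balaban1985Averaging, (10) p.19] -/
theorem measurePreserving_update_fieldMeasure {G : Type*} [GaugeGroup G] [MeasurableSpace G] [HaarData G] {j : ℕ} (b : PBond P j) :
    MeasurePreserving (fun q : GaugeField P j G × G => (update q.1 b q.2 : GaugeField P j G))
      ((fieldMeasure P j G).prod (HaarData.haar : Measure G)) (fieldMeasure P j G) := by
  unfold fieldMeasure
  exact measurePreserving_update_pi _ b

/-- The bad event is `(dU ⊗ Haar)`-null: `(z, g) ↦ z[b ↦ g]` pushes `dU ⊗ Haar` to `dU` (`measurePreserving_update`) and the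
threshold level set is `dU`-null. [cite: Balaban1987RG1, (0.4) p.253] -/
theorem prod_setOf_dist1_plaqHol_iter_update_eq_zero {j : ℕ} (hj : j ≤ P.m + P.K) (p : Plaq P j) (b : PBond P 0) {t : ℝ} (ht : t ≠ 0) :
    ((fieldMeasure P 0 (Matrix.specialUnitaryGroup (Fin 2) ℂ)).prod (HaarData.haar : Measure (Matrix.specialUnitaryGroup (Fin 2) ℂ)))
      {q : GaugeField P 0 (Matrix.specialUnitaryGroup (Fin 2) ℂ) × Matrix.specialUnitaryGroup (Fin 2) ℂ |
        dist1 (GaugeField.plaqHol (Averaging.iter (fun i => BlockAveraging.blockAvg (P := P) (j := i) ℰp) j (update q.1 b q.2)) p) = t} = 0 := by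
  have hmp := measurePreserving_update_fieldMeasure (P := P) (G := Matrix.specialUnitaryGroup (Fin 2) ℂ) b
  have hmi : Measurable (Averaging.iter (fun i => BlockAveraging.blockAvg (P := P) (j := i) ℰp) j) :=
    T4Continuum.measurable_iter _ (fun j => by rw [BlockAveraging.blockAvg_avg]; exact measurable_avgFun _ ExpMeanLog.measurable_expMeanLogSU_E) j
  have hSm : MeasurableSet {U : GaugeField P 0 (Matrix.specialUnitaryGroup (Fin 2) ℂ) |
      dist1 (GaugeField.plaqHol (Averaging.iter (fun i => BlockAveraging.blockAvg (P := P) (j := i) ℰp) j U) p) = t} :=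
    (RegularGaugeGroup.measurable_dist1.comp ((Missing.measurable_plaqHol p).comp hmi)) (measurableSet_singleton t)
  have hset : {q : GaugeField P 0 (Matrix.specialUnitaryGroup (Fin 2) ℂ) × Matrix.specialUnitaryGroup (Fin 2) ℂ |
        dist1 (GaugeField.plaqHol (Averaging.iter (fun i => BlockAveraging.blockAvg (P := P) (j := i) ℰp) j (update q.1 b q.2)) p) = t} =
      (fun q : GaugeField P 0 (Matrix.specialUnitaryGroup (Fin 2) ℂ) × Matrix.specialUnitaryGroup (Fin 2) ℂ =>
          (update q.1 b q.2 : GaugeField P 0 (Matrix.specialUnitaryGroup (Fin 2) ℂ))) ⁻¹'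
        {U : GaugeField P 0 (Matrix.specialUnitaryGroup (Fin 2) ℂ) |
          dist1 (GaugeField.plaqHol (Averaging.iter (fun i => BlockAveraging.blockAvg (P := P) (j := i) ℰp) j U) p) = t} := rfl
  rw [hset]
  exact (hmp.measure_preimage hSm.nullMeasurableSet).trans (fieldMeasure_setOf_dist1_plaqHol_iter_eq_zero hj p ht)

end SU2

end Summit.QuantumFields.YangMills.Theorems.FluctuationComparisonRegPrIntLWregChartLevelNear

end
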